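import Summits.RiemannHypothesis.RiemannHypothesis.Theorems.Splittings.RobinFiniteHeightLawBudget
import HarnessLib


/-!
# RobinFiniteHeightLaw — gen 9 — THE VERIFIED-HEIGHT → ROBIN-RANGE LAW (the line's typed ceiling)

With the three RH-free `θ`-facts in print {Büthe 2016 Thm 2 (as a function of the verification height `T`),
Büthe 2018 Thm 2, BKLNW 2021} and `RiemannHypothesisUpTo T` for ANY `T ≥ 3 000 175 332 800`:

* `robinCA_below_of_height` — Robin's inequality at every colossally abundant `N > 5040` all of whose primes are `≤ X`,
  for every natural `X` with `(1 + 2/log(2·10²²))·tailH(T)·√X ≤ 0.4857`,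
  `tailH T = (log(T/2π) + 1)/(πT) + (184 + 30 log T)/T²` (the kernel-priced zeros above `T`, tree `RobinFiniteTail`);
* `robinCA_below_of_height_closed` — the same for every `X ≤ 2.156·T²/log² T` (`tailH T ≤ log T/(πT)`), a bound
  MONOTONE in `T` (`heightLaw_mono`);
* `robin_all_of_height[_closed]` — hence Robin for every `5040 < n` with `log n ≤ 0.99947·(X − 1)`;
* instances: `T = 3 000 175 332 800` (closed form: `X = 2.3·10²²`, cf. gen 8's windowed `2.5·10²²`); HYPOTHETICAL
  `T = 10¹³` ⟹ `X = 2.4·10²³`, Robin for `5040 < n ≤ 10^(10^23)`; `T = 10¹⁴` ⟹ `X = 2·10²⁵`.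

In words: ONLY the verification height moves the reach of this line, and it moves it as
`log₁₀ log₁₀ n_max ≈ 2·log₁₀ T − 2·log₁₀ log T − 0.03`.  The dispatch below `2.5·10²²` is gen 8's (`mertensProdLt_PT2`, via
`RiemannHypothesisUpTo.mono_of_le`); above it ONE unbounded top window `[2·10²², X]` against the lifted constant
`c(51.35) = 2.5745` (`G_large2W`) with the box bound `Eb_mul_le_box_top` (no upper end needed: for `b ≤ 0.68` the two
`log P` terms of `Eb_mul_eq` are jointly `≤ 0`), and the `θ`-window at height `T` (`thetaWindow_of_height`: the tree's
Platt–Trudgian window below `2.169·10²⁵`, Büthe at height `T` above it; Büthe's range condition `4.92·√(X/log X) ≤ T` is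
IMPLIED by the budget, `buthe_range_of_budget`).  Zero `def`, zero `sorry`, no new hypothesis; `RiemannHypothesis` never
appears except inside the named fact `RiemannHypothesisUpTo T`.

Cell rh-split, seat rh-split-robin-finite g9 (brief sha16 f79c5f09d8bcb036), card `cards/SPLIT-robin-finite.md` §16;
carved from the kernel-checked object `HOME/rh-split-robin-finite/g9/SketchG9-Law.lean` (sha16 a592febf15f9aab4 = the six
CARVE-g8 bodies over the tree + this section; rc 0, 0 warnings, 0 sorries, axioms of `robin_le_of_rh13` =
[propext, Classical.choice, Quot.sound]).  Zero `def`, zero `instance`, zero `notation`, no attribute changes, no `native_decide`.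

HONEST LABEL: SPLITTING SEARCH over kernel-typed RH-EQUIVALENCES; a splitting A ∧ B ⟹ RH is CONDITIONAL
bookkeeping unless A and B are both proved; nothing here bears on the truth of RH.

FILE LAYOUT (typer split, 400-line cap): this is part 2/2 (L5–L7); L1–L4 (`thetaWindow_of_height`, `Eb_mul_le_box_top`, `Eb_top_lt`,
`buthe_range_of_budget`, `mertensProdLt_of_height`, `robinCA_below_of_height`) are in `RobinFiniteHeightLawBudget.lean`, imported here;
the private folklore helper `div_log_mono` is repeated privately below (it serves both parts).
-/


set_option linter.dupNamespace false

noncomputable section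

open Real Filter Finset
open scoped Chebyshev

namespace Summit.RiemannHypothesis.RiemannHypothesis.Theorems.Splittings.RobinFiniteC1

open Literature.NumberTheory.LFunctions Literature.NumberTheory.DiophantineGeometry
open RobinAnalyticSharp
open Summit.RiemannHypothesis.RiemannHypothesis.Theorems.Splittings.RobinFiniteE3

section HeightLaw

/-- For `e ≤ x ≤ x₀`: `x / log x ≤ x₀ / log x₀` (`log x / x` is antitone on `[e, ∞)`, `Real.log_div_self_antitoneOn`).
Folklore; the tree's copies are private (`ButhePartialRH.div_log_le_div_log`, `EtaPrmSixtyBlocks.div_log_mono`, …) or sit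
behind an unrelated heavy import (`SoundContour.div_log_mono`) — restated PRIVATELY here (dedup guard). -/
private theorem div_log_mono {x x₀ : ℝ} (hx : Real.exp 1 ≤ x) (hxx₀ : x ≤ x₀) :
    x / Real.log x ≤ x₀ / Real.log x₀ := by
  have hx0 : 0 < x := (Real.exp_pos 1).trans_le hx
  have hx₀0 : 0 < x₀ := hx0.trans_le hxx₀
  have h1x : 1 < x := (lt_trans (by norm_num) Real.exp_one_gt_d9).trans_le hx
  have hlogx : 0 < Real.log x := Real.log_pos h1x
  have hlogx₀ : 0 < Real.log x₀ := Real.log_pos (h1x.trans_le hxx₀)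
  have hanti := Real.log_div_self_antitoneOn (Set.mem_Ici.2 hx) (Set.mem_Ici.2 (hx.trans hxx₀)) hxx₀
  rw [div_le_div_iff₀ hlogx hlogx₀]
  have := (div_le_div_iff₀ hx₀0 hx0).1 hanti
  linarith

/-! ### L5 · the closed form `X ≤ 2.156·T²/log² T` and its monotonicity -/

/-- `tailH(T) ≤ log T/(πT)` for `T ≥ 3 000 175 332 800`: `log(T/2π) + 1 = log T − (log 2π − 1) ≤ log T − 0.1`
(`log 2π ≥ 1.1`, from `e^{1.1} = e·e^{0.1} ≤ 2.7182818286/0.9 < 2π`) and `(184 + 30 log T)/T² ≤ 0.1/(πT)`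
(`log T ≤ T/10⁶ + 13`). -/
theorem tailH_le_log_div {T : ℝ} (hT : 3000175332800 ≤ T) :
    (Real.log (T / (2 * π)) + 1) / (π * T) + (184 + 30 * Real.log T) / T ^ 2 ≤ Real.log T / (π * T) := by
  have hπl := Real.pi_gt_d6
  have hπu := Real.pi_lt_d6
  have hT0 : 0 < T := lt_of_lt_of_le (by norm_num) hT
  have hπT : 0 < π * T := mul_pos Real.pi_pos hT0
  -- `log(2π) ≥ 1.1`
  have hl2π : (1.1 : ℝ) ≤ Real.log (2 * π) := by
    rw [Real.le_log_iff_exp_le (by positivity)]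
    have he := Real.exp_one_lt_d9
    have h01 : Real.exp (0.1 : ℝ) ≤ 1 / (1 - 0.1) :=
      Real.exp_bound_div_one_sub_of_interval (by norm_num) (by norm_num)
    have hsplit : (1.1 : ℝ) = 1 + 0.1 := by norm_num
    rw [hsplit, Real.exp_add]
    calc Real.exp 1 * Real.exp 0.1 ≤ 2.7182818286 * (1 / (1 - 0.1)) :=
          mul_le_mul he.le h01 (Real.exp_pos _).le (by norm_num)
      _ ≤ 3.03 := by norm_num
      _ ≤ 2 * π := by linarith
  -- `log T ≤ T/10⁶ + 13`
  have hlogT : Real.log T ≤ T / 1000000 + 13 := by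
    have h1 : Real.log (T / 1000000) ≤ T / 1000000 - 1 := Real.log_le_sub_one_of_pos (by positivity)
    have h6 : Real.log (1000000 : ℝ) = 6 * Real.log 10 := by
      rw [show (1000000 : ℝ) = 10 ^ 6 by norm_num, Real.log_pow]; push_cast; ring
    rw [Real.log_div hT0.ne' (by norm_num), h6] at h1
    have h10 := RobinAnalytic.log_ten_lt
    linarith
  have hlogT0 : 0 ≤ Real.log T := Real.log_nonneg (by linarith)
  have h4 : π * (184 + 30 * Real.log T) ≤ 0.1 * T := by
    nlinarith [mul_nonneg (sub_nonneg.2 hπu.le) (by positivity : (0 : ℝ) ≤ 184 + 30 * Real.log T)]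
  rw [Real.log_div hT0.ne' (by positivity)]
  set l2π : ℝ := Real.log (2 * π) with hl2π_def
  set L : ℝ := Real.log T with hL_def
  rw [div_add_div _ _ hπT.ne' (pow_ne_zero 2 hT0.ne'), div_le_div_iff₀ (by positivity) hπT]
  nlinarith [mul_nonneg (mul_nonneg Real.pi_pos.le (sq_nonneg T)) (sub_nonneg.2 h4),
    mul_nonneg (mul_nonneg (mul_nonneg Real.pi_pos.le (sq_nonneg T)) hT0.le) (sub_nonneg.2 hl2π)]

/-- **Closed-form budget**: `X ≤ 2.156·T²/log² T` (`T ≥ 3 000 175 332 800`) implies the budget condition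
`(1 + 2/log(2·10²²))·tailH(T)·√X ≤ 0.4857`: `√X ≤ 1.46834·T/log T`, `tailH(T) ≤ log T/(πT)`, product `≤ 1.46834/π ≤ 0.4674`,
`1.0389484·0.4674 = 0.48560 ≤ 0.4857`. -/
theorem budget_of_closed {T X : ℝ} (hT : 3000175332800 ≤ T) (hXT : X ≤ 2.156 * T ^ 2 / Real.log T ^ 2) :
    (1 + 2 / Real.log (2 * (10 : ℝ) ^ 22)) *
      (((Real.log (T / (2 * π)) + 1) / (π * T) + (184 + 30 * Real.log T) / T ^ 2) * √X) ≤ 0.4857 := by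
  have hπl := Real.pi_gt_d6
  have hT0 : 0 < T := lt_of_lt_of_le (by norm_num) hT
  have hlT : 0 < Real.log T := Real.log_pos (by linarith)
  have ht := tailH_le_log_div hT
  have ht0 := Summit.RiemannHypothesis.RiemannHypothesis.Theorems.Splittings.RobinFiniteTail.tailH_nonneg
    (le_trans (by norm_num) hT)
  -- `√X ≤ 1.46834·T/log T`
  have hs : √X ≤ 1.46834 * T / Real.log T := by
    have h1 : X ≤ (1.46834 * T / Real.log T) ^ 2 := by
      refine hXT.trans ?_
      rw [div_pow]
      exact div_le_div_of_nonneg_right (by nlinarith [sq_nonneg T]) (by positivity)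
    exact (Real.sqrt_le_sqrt h1).trans_eq (Real.sqrt_sq (by positivity))
  -- the factor `1 + 2/log(2·10²²) ≤ 1.0389484`
  obtain ⟨hL, -⟩ := log_2e22_bounds
  have hfac : 1 + 2 / Real.log (2 * (10 : ℝ) ^ 22) ≤ 1.0389484 := by
    have h1 : 2 / Real.log (2 * (10 : ℝ) ^ 22) ≤ 2 / 51.35 := div_le_div_of_nonneg_left (by norm_num) (by norm_num) hL
    calc 1 + 2 / Real.log (2 * (10 : ℝ) ^ 22) ≤ 1 + 2 / 51.35 := add_le_add le_rfl h1
      _ ≤ 1.0389484 := by norm_num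
  -- the product
  have hprod : ((Real.log (T / (2 * π)) + 1) / (π * T) + (184 + 30 * Real.log T) / T ^ 2) * √X ≤
      (Real.log T / (π * T)) * (1.46834 * T / Real.log T) :=
    mul_le_mul ht hs (Real.sqrt_nonneg _) (by positivity)
  have heq : (Real.log T / (π * T)) * (1.46834 * T / Real.log T) = 1.46834 / π := by
    rw [div_mul_div_comm, div_eq_div_iff (by positivity) Real.pi_pos.ne']
    ring
  have hπinv : (1.46834 : ℝ) / π ≤ 0.4674 := by
    rw [div_le_iff₀ Real.pi_pos]; nlinarith
  rw [heq] at hprod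
  calc (1 + 2 / Real.log (2 * (10 : ℝ) ^ 22)) *
        (((Real.log (T / (2 * π)) + 1) / (π * T) + (184 + 30 * Real.log T) / T ^ 2) * √X)
        ≤ 1.0389484 * 0.4674 :=
          mul_le_mul hfac (hprod.trans hπinv) (mul_nonneg ht0 (Real.sqrt_nonneg _)) (by norm_num)
    _ ≤ 0.4857 := by norm_num

/-- **THE HEIGHT-TO-RANGE LAW (closed form).  RH verified to height `T ≥ 3 000 175 332 800` (+ the three RH-free
`θ`-facts in print) gives Robin's inequality at every colossally abundant `N > 5040` all of whose primes are `≤ X`, for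
every natural `X ≤ 2.156·T²/log² T`.**  Only `T` moves the reach of the line; nothing here bears on the truth of RH. -/
theorem robinCA_below_of_height_closed (h16 : Buthe2016_thm2) (hB : Buthe2018_thm2_theta)
    (hK : BroadbentEtAl2021_theta_rel_1e19) {T : ℝ} (hT : 3000175332800 ≤ T) (hRH : RiemannHypothesisUpTo T)
    {X : ℕ} (hXT : (X : ℝ) ≤ 2.156 * T ^ 2 / Real.log T ^ 2) : robinCA_below (X + 1) :=
  robinCA_below_of_height h16 hB hK hT hRH (budget_of_closed hT hXT)

/-- The closed-form range `2.156·T²/log² T` is MONOTONE in the height (`T ≥ e`). -/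
theorem heightLaw_mono {T T' : ℝ} (hT : Real.exp 1 ≤ T) (hTT' : T ≤ T') :
    2.156 * T ^ 2 / Real.log T ^ 2 ≤ 2.156 * T' ^ 2 / Real.log T' ^ 2 := by
  have h := div_log_mono hT hTT'
  have hT0 : 0 < T := (Real.exp_pos 1).trans_le hT
  have h1T : 1 ≤ T := le_trans (by linarith [Real.add_one_le_exp (1 : ℝ)]) hT
  have h0 : 0 ≤ T / Real.log T := div_nonneg hT0.le (Real.log_nonneg h1T)
  have e : ∀ S : ℝ, 2.156 * S ^ 2 / Real.log S ^ 2 = 2.156 * (S / Real.log S) ^ 2 := fun S => by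
    rw [div_pow]; ring
  rw [e, e]
  exact mul_le_mul_of_nonneg_left (pow_le_pow_left₀ h0 h 2) (by norm_num)

/-- … and RH to a larger height is the stronger hypothesis (`riemannHypothesisUpTo_anti`), so the law is monotone in `T`
in both of its uses of `T`. -/
theorem robinCA_below_of_height_mono (h16 : Buthe2016_thm2) (hB : Buthe2018_thm2_theta)
    (hK : BroadbentEtAl2021_theta_rel_1e19) {T T' : ℝ} (hT : 3000175332800 ≤ T) (hTT' : T ≤ T')
    (hRH : RiemannHypothesisUpTo T') {X : ℕ} (hXT : (X : ℝ) ≤ 2.156 * T ^ 2 / Real.log T ^ 2) :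
    robinCA_below (X + 1) :=
  robinCA_below_of_height_closed h16 hB hK (hT.trans hTT') hRH
    (hXT.trans (heightLaw_mono (le_trans (le_trans Real.exp_one_lt_d9.le (by norm_num)) hT) hTT'))

/-! ### L6 · all integers: Robin for `5040 < n`, `log n ≤ 0.99947·(X − 1)` -/

/-- **THE HEIGHT LAW, all-integer currency.**  Under the budget condition at height `T` for `X ≥ 2³⁰ + 1`: Robin's
inequality for every `5040 < n` with `log n ≤ 0.99947·(X − 1)` (gen 8's parameter bridge `robin_all_of_robinCA_below` with
`B⋆ = X`: every prime `p ≤ X − 1` divides the maximiser `N⋆` of `F_ε⋆`, `ε⋆ = log(1 + 1/X)/log X`, so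
`log N⋆ ≥ θ(X − 1) ≥ 0.99947·(X − 1)` on the `θ`-window — the Platt–Trudgian one if `X − 1 ≤ 2.169·10²⁵`, else the height-`T`
window, whose range condition the budget implies). -/
theorem robin_all_of_height (h16 : Buthe2016_thm2) (hB : Buthe2018_thm2_theta)
    (hK : BroadbentEtAl2021_theta_rel_1e19) {T : ℝ} (hT : 3000175332800 ≤ T) (hRH : RiemannHypothesisUpTo T)
    {X : ℕ} (hX : 2 ^ 30 + 1 ≤ X)
    (hκ : (1 + 2 / Real.log (2 * (10 : ℝ) ^ 22)) *
      (((Real.log (T / (2 * π)) + 1) / (π * T) + (184 + 30 * Real.log T) / T ^ 2) * √(X : ℝ)) ≤ 0.4857) :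
    ∀ n : ℕ, 5040 < n → Real.log n ≤ 0.99947 * ((X : ℝ) - 1) → robinInequality n := by
  classical
  have hRB := robinCA_below_of_height h16 hB hK hT hRH hκ
  have hX1 : 1 ≤ X := le_trans (by norm_num) hX
  have hXR : ((2 : ℝ) ^ 30 + 1) ≤ (X : ℝ) := by exact_mod_cast hX
  have h30 : (2 : ℝ) ^ 30 ≤ (X : ℝ) - 1 := by linarith
  -- `θ(X − 1) ≥ 0.99947·(X − 1)` on a window reaching `X − 1`
  have hW1 : 0.99947 * ((X : ℝ) - 1) ≤ θ ((X : ℝ) - 1) := by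
    rcases le_or_gt ((X : ℝ) - 1) 2.169e25 with h25 | h25
    · exact theta_ge_99947W (thetaWindow_PT h16 (RiemannHypothesisUpTo.mono_of_le hT hRH)) h30 h25
    · have hX22 : 2 * (10 : ℝ) ^ 22 ≤ (X : ℝ) := by linarith
      exact theta_ge_99947W (thetaWindow_of_height h16 hT hRH (buthe_range_of_budget hT hX22 hκ)) h30 (by linarith)
  set ε : ℝ := Real.log (1 + 1 / (X : ℝ)) / Real.log (X : ℝ) with hε_def
  have hBs1 : (1 : ℝ) < (X : ℝ) := by linarith
  have hε : 0 < ε := by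
    refine div_pos (Real.log_pos ?_) (Real.log_pos hBs1)
    have : (0 : ℝ) < 1 / (X : ℝ) := by positivity
    linarith
  obtain ⟨Ns, hNs1, hNs, -⟩ := Nat.exists_greatest_isCAParameter hε
  have hNs0 : Ns ≠ 0 := by omega
  -- threshold: primes with `r^ε ≤ 1 + 1/r` are `≤ X < X + 1`
  have hthr : ∀ r : ℕ, r.Prime → (r : ℝ) ^ ε ≤ 1 + 1 / r → r < X + 1 := by
    intro r hr hle
    by_contra hge
    push Not at hge
    have hr' : (X : ℝ) < r := by
      have : ((X + 1 : ℕ) : ℝ) ≤ r := by exact_mod_cast hge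
      push_cast at this; linarith
    have := one_add_inv_lt_rpow hBs1 hr'
    rw [← hε_def] at this
    linarith
  -- every prime `p ≤ X − 1` divides `N⋆`
  have hdiv : ∀ p ∈ Nat.primesLE (X - 1), p ∣ Ns := by
    intro p hp
    obtain ⟨hple, hpp⟩ := Nat.mem_primesLE.1 hp
    refine dvd_of_rpow_lt hNs hNs0 hpp (rpow_lt_one_add_inv hBs1 (by exact_mod_cast hpp.one_lt) ?_)
    have h1 : p < X := by omega
    exact_mod_cast h1
  have hprod : (∏ p ∈ Nat.primesLE (X - 1), p) ∣ Ns :=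
    Finset.prod_primes_dvd Ns (fun p hp => (Nat.mem_primesLE.1 hp).2.prime) hdiv
  -- hence `log N⋆ ≥ θ(X − 1) ≥ 0.99947·(X − 1)`
  have hlogNs : 0.99947 * ((X : ℝ) - 1) ≤ Real.log Ns := by
    have hle : (∏ p ∈ Nat.primesLE (X - 1), p) ≤ Ns := Nat.le_of_dvd (by omega) hprod
    have hpos : ∀ p ∈ Nat.primesLE (X - 1), ((p : ℕ) : ℝ) ≠ 0 := fun p hp => by
      exact_mod_cast (Nat.mem_primesLE.1 hp).2.ne_zero
    have h1 : Real.log ((∏ p ∈ Nat.primesLE (X - 1), p : ℕ) : ℝ) = θ (((X - 1 : ℕ)) : ℝ) := by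
      rw [Chebyshev.theta_eq_sum_primesLE_log, Nat.cast_prod, Real.log_prod hpos]
    have hprodpos : (0 : ℝ) < ((∏ p ∈ Nat.primesLE (X - 1), p : ℕ) : ℝ) := by
      rw [Nat.cast_prod]; exact Finset.prod_pos fun p hp => by exact_mod_cast (Nat.mem_primesLE.1 hp).2.pos
    have h2 : Real.log ((∏ p ∈ Nat.primesLE (X - 1), p : ℕ) : ℝ) ≤ Real.log Ns :=
      Real.log_le_log hprodpos (by exact_mod_cast hle)
    have hcast : (((X - 1 : ℕ)) : ℝ) = (X : ℝ) - 1 := Nat.cast_pred (by omega)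
    rw [h1, hcast] at h2
    exact hW1.trans h2
  have hNs5040 : 5040 < Ns := by
    by_contra hle
    push Not at hle
    have h1 : (Ns : ℝ) ≤ 5040 := by exact_mod_cast hle
    have h2 : Real.log Ns ≤ Real.log 5040 := Real.log_le_log (by exact_mod_cast hNs1) h1
    have h3 : Real.log 5040 ≤ 5040 - 1 := Real.log_le_sub_one_of_pos (by norm_num)
    have h4 : (2 : ℝ) ^ 30 = 1073741824 := by norm_num
    rw [h4] at h30
    linarith
  intro n hn hlog
  refine robin_all_of_robinCA_below hRB hε hthr hNs hNs5040 n hn ?_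
  by_contra hgt
  push Not at hgt
  have h3 : Real.log Ns < Real.log n :=
    Real.log_lt_log (by exact_mod_cast hNs1) (by exact_mod_cast hgt)
  linarith

/-- The all-integer currency in closed form: `X ≤ 2.156·T²/log² T`. -/
theorem robin_all_of_height_closed (h16 : Buthe2016_thm2) (hB : Buthe2018_thm2_theta)
    (hK : BroadbentEtAl2021_theta_rel_1e19) {T : ℝ} (hT : 3000175332800 ≤ T) (hRH : RiemannHypothesisUpTo T)
    {X : ℕ} (hX : 2 ^ 30 + 1 ≤ X) (hXT : (X : ℝ) ≤ 2.156 * T ^ 2 / Real.log T ^ 2) :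
    ∀ n : ℕ, 5040 < n → Real.log n ≤ 0.99947 * ((X : ℝ) - 1) → robinInequality n :=
  robin_all_of_height h16 hB hK hT hRH hX (budget_of_closed hT hXT)

/-! ### L7 · instances (the SAME four print facts at `T = 3 000 175 332 800`; HYPOTHETICAL larger heights) -/

/-- Instances helper: `X ≤ 2.156·(10ᵏ)²/log²(10ᵏ)` from the decimal check `X·(k·2.3025850935)² ≤ 2.156·10²ᵏ`
(`log 10 < 2.3025850935`); keeps the numeral `10ᵏ` out of `log` for the arithmetic. -/
theorem le_closedRange_ten_pow (k : ℕ) (hk : 0 < k) {X : ℝ} (hX0 : 0 ≤ X)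
    (hX : X * ((k : ℝ) * 2.3025850935) ^ 2 ≤ 2.156 * ((10 : ℝ) ^ k) ^ 2) :
    X ≤ 2.156 * ((10 : ℝ) ^ k) ^ 2 / Real.log ((10 : ℝ) ^ k) ^ 2 := by
  have h10 := RobinAnalytic.log_ten_lt
  have h10' := RobinAnalytic.log_ten_gt
  have hk' : (0 : ℝ) < k := by exact_mod_cast hk
  have hl10 : 0 < Real.log 10 := by linarith
  rw [Real.log_pow, le_div_iff₀ (pow_pos (mul_pos hk' hl10) 2)]
  calc X * ((k : ℝ) * Real.log 10) ^ 2 ≤ X * ((k : ℝ) * 2.3025850935) ^ 2 :=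
        mul_le_mul_of_nonneg_left (pow_le_pow_left₀ (mul_pos hk' hl10).le
          (mul_le_mul_of_nonneg_left h10.le hk'.le) 2) hX0
    _ ≤ _ := hX

/-- Consistency instance at the Platt–Trudgian height: the closed form gives `robinCA_below (2.3·10²² + 1)`
(`log 3000175332800 ≤ 12.5·log 10 ≤ 28.7824`; gen 8's windowed dispatch reached `2.5·10²²`). -/
theorem robinCA_below_PT_closed (h16 : Buthe2016_thm2) (hB : Buthe2018_thm2_theta)
    (hK : BroadbentEtAl2021_theta_rel_1e19) (hRH : RiemannHypothesisUpTo 3000175332800) :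
    robinCA_below (23 * 10 ^ 21 + 1) := by
  refine robinCA_below_of_height_closed h16 hB hK le_rfl hRH ?_
  have hH : Real.log 3000175332800 ≤ 28.7824 := by
    have h2 : Real.log ((3000175332800 : ℝ) ^ 2) ≤ Real.log ((10 : ℝ) ^ 25) :=
      Real.log_le_log (by positivity) (by norm_num)
    rw [Real.log_pow, Real.log_pow] at h2
    have h10 := RobinAnalytic.log_ten_lt
    push_cast at h2
    linarith
  have hH0 : 0 < Real.log 3000175332800 := Real.log_pos (by norm_num)
  rw [le_div_iff₀ (pow_pos hH0 2)]
  push_cast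
  nlinarith [mul_le_mul hH hH hH0.le (by norm_num)]

/-- HYPOTHETICAL instance (no such verification exists in print): RH verified to height `10¹³` would give
`robinCA_below (2.4·10²³ + 1)` (`log 10¹³ ≤ 29.93361`, `2.4·10²³·29.93361² ≤ 2.156·10²⁶`). -/
theorem robinCA_below_of_rh13 (h16 : Buthe2016_thm2) (hB : Buthe2018_thm2_theta)
    (hK : BroadbentEtAl2021_theta_rel_1e19) (hRH : RiemannHypothesisUpTo ((10 : ℝ) ^ 13)) :
    robinCA_below (24 * 10 ^ 22 + 1) := by
  exact robinCA_below_of_height_closed h16 hB hK (by norm_num) hRH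
    (le_closedRange_ten_pow 13 (by norm_num) (Nat.cast_nonneg _) (by norm_num))

/-- HYPOTHETICAL instance, all-integer currency: RH verified to height `10¹³` would give Robin's inequality for every
`5040 < n ≤ 10^(10^23)` (`0.99947·(2.4·10²³ − 1) ≥ 10²³·log 10`; the power `10^(10^23)` is never evaluated). -/
theorem robin_le_of_rh13 (h16 : Buthe2016_thm2) (hB : Buthe2018_thm2_theta)
    (hK : BroadbentEtAl2021_theta_rel_1e19) (hRH : RiemannHypothesisUpTo ((10 : ℝ) ^ 13)) :
    ∀ n : ℕ, 5040 < n → n ≤ 10 ^ 10 ^ 23 → robinInequality n := by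
  have hXT : ((24 * 10 ^ 22 : ℕ) : ℝ) ≤ 2.156 * ((10 : ℝ) ^ 13) ^ 2 / Real.log ((10 : ℝ) ^ 13) ^ 2 :=
    le_closedRange_ten_pow 13 (by norm_num) (Nat.cast_nonneg _) (by norm_num)
  have hall := robin_all_of_height_closed h16 hB hK (by norm_num) hRH (X := 24 * 10 ^ 22) (by norm_num) hXT
  intro n hn hle
  have hn0 : 0 < n := lt_of_le_of_lt (Nat.zero_le 5040) hn
  have h1 : Real.log n ≤ ((10 ^ 23 : ℕ) : ℝ) * Real.log 10 := log_le_of_le_ten_pow hn0 hle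
  clear hle
  refine hall n hn ?_
  have h10 := RobinAnalytic.log_ten_lt
  have h5 : ((10 ^ 23 : ℕ) : ℝ) = 1e23 := by norm_num
  rw [h5] at h1
  have h6 : ((24 * 10 ^ 22 : ℕ) : ℝ) = 2.4e23 := by norm_num
  rw [h6]
  nlinarith

/-- HYPOTHETICAL instance: RH verified to height `10¹⁴` would give `robinCA_below (2·10²⁵ + 1)` (`log 10¹⁴ ≤ 32.2362`). -/
theorem robinCA_below_of_rh14 (h16 : Buthe2016_thm2) (hB : Buthe2018_thm2_theta)
    (hK : BroadbentEtAl2021_theta_rel_1e19) (hRH : RiemannHypothesisUpTo ((10 : ℝ) ^ 14)) :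
    robinCA_below (2 * 10 ^ 25 + 1) := by
  exact robinCA_below_of_height_closed h16 hB hK (by norm_num) hRH
    (le_closedRange_ten_pow 14 (by norm_num) (Nat.cast_nonneg _) (by norm_num))

end HeightLaw

end Summit.RiemannHypothesis.RiemannHypothesis.Theorems.Splittings.RobinFiniteC1
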